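/-
Copyright (c) 2026 the pub-hodgecm-mathlib formalisation cell (harness21).  Prover seat hodgecm-mathlib-LH7-p05 (g0), req620 Track A «(D-RAM) FOUR-FRAME» squad, helper lane on
h413 = stmt-HodgeConjecture-24833 (count-neutral).  β-BOARD v1 row R7 «GLUE CLASSES» — Theorem C bricks, FILE ASM-1b «THE SLOT SIGNS ON THE WINDOW, LINEARISED».  2026-09-04.
-/
import Summits.HodgeConjecture.HodgeConjecture.Theorems.F0P3cDyRamGlueShellLinearisation      -- ★ p861522 (LH7-p07 (g0)): `normSign_add_eq_of_v_le`, `normSign_eq_one_of_mem_deep`; brings ★ toolkit `normSign_mul_of_fixed`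
import Summits.HodgeConjecture.HodgeConjecture.Theorems.F0P3cDyRamGlueResidueSystems            -- ★ p861478 (LH7-p07 (g0)): `image_one_add_existsUnique`, `image_one_add_sub`
import Summits.HodgeConjecture.HodgeConjecture.Theorems.F0P3cDyRamDiagonalFixedClassSystems      -- ★ κG-B1 (LH4-p09 (g3)): `exists_repr_fixedBall_card`, `v_le_pow_succ_succ_of_fixed_of_v_lt`; brings ★ (iv-c)
import Literature.NumberTheory.Automorphic.UnitaryLatticeTreeWeightedGauss                      -- ★ `v_eq_one_of_v_sub_one_lt_one`
import HarnessLib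

/-!
# Crux `H413`, line LH4 «(D-RAM) FOUR-FRAME» — (β) Stage B, β-BOARD row R7, Theorem C («foot window») bricks, FILE ASM-1b:
# THE PRODUCT `ω(D_i)·ω(class_i)·ω(label)` OF ★ p861678's HEAD IS `ω(g_α)·G_i(r)` IN THE LINEAR LETTER `r = g + (1+g)(a_β − 1)`, AND THE NORM-CLASS SYSTEMS EXIST

Cell `hodgecm-mathlib` (D-0151), FLOOR 0, crux item H413 = `stmt-HodgeConjecture-24833`, route `HCCMUnconditional`; squad F0∕P3c∕LH4 (β-table fan, sub-dealer LH4-p05 (g8)).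
THEOREMS ONLY (no `def`, no instance, no notation, no `sorry`, default heartbeats); ★-only imports; lane `--supports stmt-HodgeConjecture-24833 --as helper` (count-neutral);
pays NO row, states NO law.  Consumer: this seat's Theorem C assembly (ASM-2) between ★ p861678 `labelledOddCount_div_relIndex_glued_rep_eq` (per-representative class-sign
sum `Σ_{aβ} Σ_{aγ} ω(class_i)·ω(g g_α + aγ T⁻¹ g_β)` behind the factor `ω(D_i)`) and LH7-p07 (g0)'s ★ p861670 window sums (`Σ_{g} Σ_{aβ} G_i(g + (1+g)(aβ − 1)) = 0` for
`G₀ = ω(r(r + c₀))`, `G₁ = ω(r + c₀)`, `G₂ = ω((1 + r)(r + c₀))`).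

THE MATHEMATICS (ROADMAP-R7-TheoremC v1 §2, LH7-p07's ★ `label_arg_eq`).  Letters: `P = π₀^{ρ+t′}` (`π₀ = ϖσϖ`, a norm, so `ω(P⁻¹) = 1`), `D = (P⁻¹g, P⁻¹, −P⁻¹(1+g)⁻¹)`,
`T = aβ + g⁻¹(aβ − 1)`, `r = g + (1 + g)(aβ − 1)` (so `g·T = r`, `(1 + g)·aβ = 1 + r`), `c₀ = g_β∕g_α`, class vector `(1, aγ T⁻¹, aγ T⁻¹ aβ)`, label argument
`L = g g_α + aγ T⁻¹ g_β = T⁻¹·(g_α (r + c₀) + (aγ − 1) g_β)`.  On the cut `|g + c₀| = |ϖ|^{2t′+E}` (`E < ρ`) one has `|r + c₀| = |ϖ|^{2t′+E}` and the `aγ`-perturbation is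
relatively `2ρ − E ≥ 2d − 1` deep, so `ω(L) = ω(T)·ω(g_α)·ω(r + c₀)` (★ `normSign_add_eq_of_v_le`), `ω(T) = ω(g)ω(r)`, `ω(aγ) = 1` (`2ρ ≥ 2d − 1`); multiplying out with
`ω² = 1`: slot 0 `ω(g_α)·ω(r(r + c₀))`, slot 1 `ω(g_α)·ω(r + c₀)`, slot 2 `ω(−1)ω(g_α)·ω((1 + r)(r + c₀))` — `classSign_mul_labelSign_eq` (with `L ≠ 0`).
§2 `exists_normClass_system`: a finite `A ⊆ U_F^{[n]}` meeting every norm class `y·N(U^{[k]})`, `y ∈ U_F^{[n]}`, exactly once (★ `exists_repr_fixedBall_card` at the even level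
`2⌈n∕2⌉` and modulus `2M`, shifted by `1`, through ★ `image_one_add_existsUnique`; the ★ PT-3 letters of `Aβ`, `Aγ`).
HONEST LABEL: count-neutral; Theorem C ∕ hRest ∕ (β-BAL) ∕ (β) ∕ T₊ OPEN; `HC_CM` is proved only modulo the 7 printed citations (2 remaining named inputs: hLiu418 =
`stmt-HodgeConjecture-24832`, h413 = `stmt-HodgeConjecture-24833`) until rung 0 closes.
References: [Kottwitz1986BaseChangeUnits] §1 pp. 240–241 · [Rogawski1990] §4.9 Prop. 4.9.1 (a)(b) p. 55 · [Serre1979] Ch. V §3 Cor. 3, Ch. XV §2 · [Serre1980Trees] Ch. II §1.1.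
-/

set_option autoImplicit false

noncomputable section

namespace Summit.HodgeConjecture.HodgeConjecture.Cruxes.H413.F0P3cDyRamLabelledOddGlueWindowSigns

open Matrix WithZero
open Literature.NumberTheory.Automorphic Literature.NumberTheory.Automorphic.HermitianLattice
open Literature.NumberTheory.Automorphic.UnitaryLatticeTree Literature.NumberTheory.Automorphic.UnitaryThreeFourFrame
open Literature.NumberTheory.LocalFields Literature.NumberTheory.LocalFields.WildQuadraticDatum
open Summit.HodgeConjecture.HodgeConjecture.Cruxes.H413.F0P3cDyRamGlueShellLinearisation (normSign_add_eq_of_v_le normSign_eq_one_of_mem_deep)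
open Summit.HodgeConjecture.HodgeConjecture.Cruxes.H413.F0P3cDyRamGlueResidueSystems (image_one_add_existsUnique image_one_add_sub)
open Summit.HodgeConjecture.HodgeConjecture.Cruxes.H413.F0P3cDyRamDiagonalFixedClassSystems (exists_repr_fixedBall_card v_le_pow_succ_succ_of_fixed_of_v_lt)
open Summit.HodgeConjecture.HodgeConjecture.Cruxes.H413.F0P3cDyRamDiagonalGluedClassRepresentatives (v_mul_map_pow map_mul_map_eq)
open scoped Valued WithZero Matrix

variable {K : Type} [Field K] [Valued K ℤᵐ⁰] {σ : K →+* K} {ϖ : K} {d t : ℕ}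

/-! ## §1  The slot signs, linearised -/

/-- **THE SLOT SIGN PRODUCT OF ★ p861678'S HEAD, LINEARISED** (ROADMAP-R7 §2): on the window cut `|g + g_β∕g_α| = |ϖ|^{2t′+E}` (`E < ρ`, `2d − 1 + E ≤ 2ρ`), for `aβ ∈ U_F^{[ρ+2t′]}`,
`aγ ∈ U_F^{[2ρ]}`, the label argument `g g_α + aγ T⁻¹ g_β` is non-zero and `ω(D_i)·(ω(class_i)·ω(g g_α + aγ T⁻¹ g_β)) = ω(g_α)·G_i(r)`, `r = g + (1+g)(aβ − 1)`, with
`G₀ r = ω(r(r + c₀))`, `G₁ r = ω(r + c₀)`, `G₂ r = ω(−1)·ω((1 + r)(r + c₀))`, `c₀ = g_β∕g_α`. [cite: Kottwitz1986BaseChangeUnits, §1 pp. 240–241] [cite: Serre1979, Ch. XV §2] -/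
theorem classSign_mul_labelSign_eq [CompleteSpace K] [Finite 𝓀[K]] (hD : IsRamifiedQuadraticDatum σ ϖ d t)
    {ρ t' E : ℕ} (ht' : 1 ≤ t') (hEρ : E < ρ) (hdeep : 2 * d - 1 + E ≤ 2 * ρ)
    {g : K} (hσg : σ g = g) (hg : Valued.v g = Valued.v ϖ ^ (2 * t'))
    {gα gβ : K} (hσgα : σ gα = gα) (hσgβ : σ gβ = gβ) (hgα0 : gα ≠ 0) (hc₀ : Valued.v (gβ / gα) = Valued.v ϖ ^ (2 * t'))
    (hcut : Valued.v (g + gβ / gα) = Valued.v ϖ ^ (2 * t' + E))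
    {aβ aγ : K} (hσaβ : σ aβ = aβ) (haβ : Valued.v (aβ - 1) ≤ Valued.v ϖ ^ (ρ + 2 * t')) (hσaγ : σ aγ = aγ) (haγ : Valued.v (aγ - 1) ≤ Valued.v ϖ ^ (2 * ρ))
    (i : Fin 3) :
    g * gα + aγ * (aβ + g⁻¹ * (aβ - 1))⁻¹ * gβ ≠ 0 ∧
      normSign σ ((![((ϖ * σ ϖ) ^ (ρ + t'))⁻¹ * g, ((ϖ * σ ϖ) ^ (ρ + t'))⁻¹, -(((ϖ * σ ϖ) ^ (ρ + t'))⁻¹ * (1 + g)⁻¹)] : Fin 3 → K) i) *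
          (normSign σ ((![(1 : K), aγ * (aβ + g⁻¹ * (aβ - 1))⁻¹, aγ * (aβ + g⁻¹ * (aβ - 1))⁻¹ * aβ] : Fin 3 → K) i) *
            normSign σ (g * gα + aγ * (aβ + g⁻¹ * (aβ - 1))⁻¹ * gβ)) =
        normSign σ gα * (![normSign σ ((g + (1 + g) * (aβ - 1)) * ((g + (1 + g) * (aβ - 1)) + gβ / gα)),
          normSign σ ((g + (1 + g) * (aβ - 1)) + gβ / gα),
          normSign σ (-1) * normSign σ ((1 + (g + (1 + g) * (aβ - 1))) * ((g + (1 + g) * (aβ - 1)) + gβ / gα))] : Fin 3 → ℤ) i := by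
  classical
  have hD' := hD
  obtain ⟨hσ, hvσ, hϖ, -, -, -, -⟩ := hD'
  have hϖ0 : ϖ ≠ 0 := fun h0 => by rw [h0, map_zero] at hϖ; exact WithZero.coe_ne_zero hϖ.symm
  have hvϖ : Valued.v ϖ ≠ 0 := (Valuation.ne_zero_iff _).2 hϖ0
  have hϖ1 : Valued.v ϖ < 1 := by rw [hϖ, ← exp_zero, exp_lt_exp]; norm_num
  have hpwlt : ∀ a b : ℕ, Valued.v ϖ ^ a < Valued.v ϖ ^ b ↔ b < a := fun a b => by
    rw [v_varpi_pow hϖ, v_varpi_pow hϖ, exp_lt_exp]; omega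
  have hne : ∀ {x : K} {k : ℕ}, Valued.v x = Valued.v ϖ ^ k → x ≠ 0 := fun hx h0 => by
    rw [h0, map_zero] at hx; exact pow_ne_zero _ hvϖ hx.symm
  have hsq : ∀ x : K, normSign σ x * normSign σ x = 1 := fun x => by unfold normSign; split_ifs <;> norm_num
  -- the letters
  set P : K := (ϖ * σ ϖ) ^ (ρ + t') with hP
  set c₀ : K := gβ / gα with hc₀def
  set T : K := aβ + g⁻¹ * (aβ - 1) with hT
  set r : K := g + (1 + g) * (aβ - 1) with hr
  have hσP : σ P = P := by rw [hP, map_pow, map_mul_map_eq hσ]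
  have hP0 : P ≠ 0 := hne (v_mul_map_pow hvσ ϖ (ρ + t'))
  have hσc₀ : σ c₀ = c₀ := by rw [hc₀def, map_div₀, hσgα, hσgβ]
  have hg0 : g ≠ 0 := hne hg
  have hvg1 : Valued.v g < 1 := by rw [hg]; exact pow_lt_one₀ zero_le hϖ1 (by omega)
  have h1g : Valued.v (1 + g) = 1 := by rw [Valuation.map_add_eq_of_lt_left _ (by rwa [map_one]), map_one]
  have h1g0 : 1 + g ≠ 0 := fun h => by rw [h, map_zero] at h1g; exact zero_ne_one h1g
  have haβ1 : Valued.v aβ = 1 := v_eq_one_of_v_sub_one_lt_one (haβ.trans_lt (pow_lt_one₀ zero_le hϖ1 (by omega)))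
  have haγ1 : Valued.v aγ = 1 := v_eq_one_of_v_sub_one_lt_one (haγ.trans_lt (pow_lt_one₀ zero_le hϖ1 (by omega)))
  have haβ0 : aβ ≠ 0 := fun h => by rw [h, map_zero] at haβ1; exact zero_ne_one haβ1
  have haγ0 : aγ ≠ 0 := fun h => by rw [h, map_zero] at haγ1; exact zero_ne_one haγ1
  have hgT : g * T = r := by rw [hT, hr, mul_add, ← mul_assoc, mul_inv_cancel₀ hg0]; ring
  have hvr : Valued.v r = Valued.v ϖ ^ (2 * t') := by
    rw [hr, Valuation.map_add_eq_of_lt_left _ ?_, hg]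
    rw [hg, map_mul, h1g, one_mul]
    exact haβ.trans_lt ((hpwlt _ _).2 (by omega))
  have hr0 : r ≠ 0 := hne hvr
  have hTeq : T = g⁻¹ * r := by rw [← hgT, ← mul_assoc, inv_mul_cancel₀ hg0, one_mul]
  have hT0 : T ≠ 0 := by rw [hTeq]; exact mul_ne_zero (inv_ne_zero hg0) hr0
  have hvrc : Valued.v (r + c₀) = Valued.v ϖ ^ (2 * t' + E) := by
    rw [show r + c₀ = g + c₀ + (1 + g) * (aβ - 1) by rw [hr]; ring, Valuation.map_add_eq_of_lt_left _ ?_, hcut]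
    rw [hcut, map_mul, h1g, one_mul]
    exact haβ.trans_lt ((hpwlt _ _).2 (by omega))
  have hrc0 : r + c₀ ≠ 0 := hne hvrc
  have h1r : 1 + r = (1 + g) * aβ := by rw [hr]; ring
  have h1r0 : 1 + r ≠ 0 := by rw [h1r]; exact mul_ne_zero h1g0 haβ0
  have hσT : σ T = T := by rw [hT, map_add, map_mul, map_inv₀, map_sub, map_one, hσg, hσaβ]
  have hσr : σ r = r := by rw [hr, map_add, map_mul, map_add, map_sub, map_one, hσg, hσaβ]
  have hσrc : σ (r + c₀) = r + c₀ := by rw [map_add, hσr, hσc₀]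
  have hσ1r : σ (1 + r) = 1 + r := by rw [map_add, map_one, hσr]
  have hvgβ : Valued.v gβ = Valued.v ϖ ^ (2 * t') * Valued.v gα := by
    rw [← hc₀, hc₀def, map_div₀, div_mul_cancel₀ _ ((Valuation.ne_zero_iff _).2 hgα0)]
  -- the label argument, linearised
  have hLeq : g * gα + aγ * T⁻¹ * gβ = T⁻¹ * (gα * (r + c₀) + (aγ - 1) * gβ) := by
    rw [hTeq, hc₀def, mul_inv, inv_inv]; field_simp; ring
  have hpert : Valued.v ((aγ - 1) * gβ) ≤ Valued.v ϖ ^ (2 * ρ - E) * Valued.v (gα * (r + c₀)) := by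
    rw [map_mul, map_mul, hvrc, hvgβ, show Valued.v ϖ ^ (2 * ρ - E) * (Valued.v gα * Valued.v ϖ ^ (2 * t' + E)) =
      Valued.v ϖ ^ (2 * ρ) * (Valued.v ϖ ^ (2 * t') * Valued.v gα) by
        rw [mul_comm (Valued.v gα) (Valued.v ϖ ^ (2 * t' + E)), ← mul_assoc, ← pow_add, ← mul_assoc, ← pow_add]; congr 2; omega]
    gcongr
  have hmain0 : gα * (r + c₀) ≠ 0 := mul_ne_zero hgα0 hrc0
  have hσmain : σ (gα * (r + c₀)) = gα * (r + c₀) := by rw [map_mul, hσgα, hσrc]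
  have hσpert : σ ((aγ - 1) * gβ) = (aγ - 1) * gβ := by rw [map_mul, map_sub, map_one, hσaγ, hσgβ]
  have hsum0 : gα * (r + c₀) + (aγ - 1) * gβ ≠ 0 := by
    intro h0
    have hlt : Valued.v ((aγ - 1) * gβ) < Valued.v (gα * (r + c₀)) := by
      refine hpert.trans_lt ?_
      conv_rhs => rw [← one_mul (Valued.v (gα * (r + c₀)))]
      exact mul_lt_mul_of_pos_right (pow_lt_one₀ zero_le hϖ1 (by omega)) ((Valuation.pos_iff _).2 hmain0)
    have := Valuation.map_add_eq_of_lt_left Valued.v hlt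
    rw [h0, map_zero] at this
    exact hmain0 ((Valuation.zero_iff _).1 this.symm)
  have hωL : normSign σ (g * gα + aγ * T⁻¹ * gβ) = normSign σ T * (normSign σ gα * normSign σ (r + c₀)) := by
    rw [hLeq, normSign_mul_of_fixed hD (by rw [map_inv₀, hσT]) (by rw [map_add, hσmain, hσpert]) (inv_ne_zero hT0) hsum0,
      normSign_inv_of_map_eq σ hσT hT0, normSign_add_eq_of_v_le hD hσmain hσpert hmain0 (n := 2 * ρ - E) (by omega) hpert,
      normSign_mul_of_fixed hD hσgα hσrc hgα0 hrc0]
  have hωT : normSign σ T = normSign σ g * normSign σ r := by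
    rw [hTeq, normSign_mul_of_fixed hD (by rw [map_inv₀, hσg]) hσr (inv_ne_zero hg0) hr0, normSign_inv_of_map_eq σ hσg hg0]
  have hωTinv : normSign σ T⁻¹ = normSign σ g * normSign σ r := by rw [normSign_inv_of_map_eq σ hσT hT0, hωT]
  have hωP : normSign σ P⁻¹ = 1 := by
    rw [normSign_inv_of_map_eq σ hσP hP0]
    exact normSign_of_isNorm σ ⟨ϖ ^ (ρ + t'), by rw [hP, map_pow, ← mul_pow]⟩
  have hωaγ : normSign σ aγ = 1 := normSign_eq_one_of_mem_deep hD (by omega) hσaγ haγ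
  have hL0 : g * gα + aγ * T⁻¹ * gβ ≠ 0 := by rw [hLeq]; exact mul_ne_zero (inv_ne_zero hT0) hsum0
  refine ⟨hL0, ?_⟩
  fin_cases i
  · -- slot 0: `ω(P⁻¹ g)·(ω(1)·ω(L)) = ω(g_α)·ω(r(r + c₀))`
    simp only [Fin.zero_eta, Fin.isValue, Matrix.cons_val_zero]
    rw [normSign_mul_of_fixed hD (by rw [map_inv₀, hσP]) hσg (inv_ne_zero hP0) hg0, hωP, normSign_one, hωL, hωT,
      normSign_mul_of_fixed hD hσr hσrc hr0 hrc0]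
    linear_combination (normSign σ r * (normSign σ gα * normSign σ (r + c₀))) * hsq g
  · -- slot 1: `ω(P⁻¹)·(ω(aγ T⁻¹)·ω(L)) = ω(g_α)·ω(r + c₀)`
    simp only [Fin.mk_one, Fin.isValue, Matrix.cons_val_one, Matrix.cons_val_zero]
    rw [hωP, normSign_mul_of_fixed hD hσaγ (by rw [map_inv₀, hσT]) haγ0 (inv_ne_zero hT0), hωaγ, hωTinv, hωL, hωT]
    linear_combination (normSign σ gα * normSign σ (r + c₀)) * (hsq g * (normSign σ r * normSign σ r) + hsq r)
  · -- slot 2: `ω(−P⁻¹(1+g)⁻¹)·(ω(aγ T⁻¹ aβ)·ω(L)) = ω(−1)ω(g_α)·ω((1 + r)(r + c₀))`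
    simp only [Fin.reduceFinMk, Matrix.cons_val_two, Matrix.tail_cons, Matrix.head_cons]
    have hσm : σ (P⁻¹ * (1 + g)⁻¹) = P⁻¹ * (1 + g)⁻¹ := by rw [map_mul, map_inv₀, map_inv₀, hσP, map_add, map_one, hσg]
    have hm0 : P⁻¹ * (1 + g)⁻¹ ≠ 0 := mul_ne_zero (inv_ne_zero hP0) (inv_ne_zero h1g0)
    rw [show -(P⁻¹ * (1 + g)⁻¹) = -1 * (P⁻¹ * (1 + g)⁻¹) by ring,
      normSign_mul_of_fixed hD (by rw [map_neg, map_one]) hσm (by norm_num) hm0,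
      normSign_mul_of_fixed hD (by rw [map_inv₀, hσP]) (by rw [map_inv₀, map_add, map_one, hσg]) (inv_ne_zero hP0) (inv_ne_zero h1g0), hωP,
      normSign_inv_of_map_eq σ (by rw [map_add, map_one, hσg]) h1g0,
      normSign_mul_of_fixed hD (by rw [map_mul, hσaγ, map_inv₀, hσT]) hσaβ (mul_ne_zero haγ0 (inv_ne_zero hT0)) haβ0,
      normSign_mul_of_fixed hD hσaγ (by rw [map_inv₀, hσT]) haγ0 (inv_ne_zero hT0), hωaγ, hωTinv, hωL, hωT,
      normSign_mul_of_fixed hD hσ1r hσrc h1r0 hrc0, h1r, normSign_mul_of_fixed hD (by rw [map_add, map_one, hσg]) hσaβ h1g0 haβ0]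
    linear_combination (normSign σ (-1) * normSign σ (1 + g) * normSign σ aβ * normSign σ gα * normSign σ (r + c₀)) *
      (hsq g * (normSign σ r * normSign σ r) + hsq r)

/-! ## §2  Norm-class systems exist -/

/-- **A NORM-CLASS SYSTEM OF `U_F^{[n]}` EXISTS** (the ★ PT-3 letters of `Aβ`∕`Aγ`): for `n ≥ 1` and the exponents of record `(k, M)` with `2M ≤ k + d ≤ 2M + 1`, `d ≤ M ≤ k`,
`n ≤ 2M`, there is a finite `A` of fixed `a` with `|a − 1| ≤ |ϖ|^n` such that every fixed `y` with `|y − 1| ≤ |ϖ|^n` has EXACTLY ONE `a ∈ A` with `a∕y ∈ N(U^{[k]})` (★ κG-B1's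
additive system of the fixed ball of even level `2⌈n∕2⌉` modulo `𝔭^{2M}`, shifted by `1`; ★ p861478's bridge). [cite: Serre1979, Ch. IV §2 Prop. 6, Ch. V §3 Prop. 5] -/
theorem exists_normClass_system [CompleteSpace K] [Finite 𝓀[K]] [DecidableEq K] (hD : IsRamifiedQuadraticDatum σ ϖ d t) {n k M : ℕ} (hn : 1 ≤ n)
    (hMk : 2 * M ≤ k + d) (hkM : k + d ≤ 2 * M + 1) (hdM : d ≤ M) (hMk2 : M ≤ k) (hnM : n ≤ 2 * M) :
    ∃ A : Finset K, (∀ a ∈ A, σ a = a ∧ Valued.v (a - 1) ≤ Valued.v ϖ ^ n) ∧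
      ∀ y : K, σ y = y → Valued.v (y - 1) ≤ Valued.v ϖ ^ n →
        ∃! a, a ∈ A ∧ ∃ s : K, Valued.v (s - 1) ≤ Valued.v ϖ ^ k ∧ s * σ s = a / y := by
  have hD' := hD
  obtain ⟨hσ, hvσ, hϖ, hfix, hd, -, -⟩ := hD'
  have hϖ1 : Valued.v ϖ < 1 := by rw [hϖ, ← exp_zero, exp_lt_exp]; norm_num
  have hpw : ∀ a b : ℕ, Valued.v ϖ ^ a ≤ Valued.v ϖ ^ b ↔ b ≤ a := fun a b => by
    rw [v_varpi_pow hϖ, v_varpi_pow hϖ, exp_le_exp]; omega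
  have hpwlt : ∀ a b : ℕ, Valued.v ϖ ^ a < Valued.v ϖ ^ b ↔ b < a := fun a b => by
    rw [v_varpi_pow hϖ, v_varpi_pow hϖ, exp_lt_exp]; omega
  -- the even level `2u ∈ {n, n+1}` and the modulus `2M = ρ' + 2u`
  set u : ℕ := (n + 1) / 2 with hu
  have hu1 : n ≤ 2 * u := by omega
  have hu2 : 2 * u ≤ n + 1 := by omega
  have huM : 2 * u ≤ 2 * M := by omega
  obtain ⟨B, hB1, hB2, hB3, -⟩ := exists_repr_fixedBall_card hσ hvσ hfix hϖ hd (2 * M - 2 * u) u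
  have hmod : 2 * M - 2 * u + 2 * u = 2 * M := by omega
  rw [hmod] at hB2 hB3
  -- the level-`n` letters of `B`
  have hB1' : ∀ b ∈ B, σ b = b ∧ Valued.v b ≤ Valued.v ϖ ^ n := fun b hb => ⟨(hB1 b hb).1, (hB1 b hb).2.trans ((hpw _ _).2 hu1)⟩
  have hB2' : ∀ b : K, σ b = b → Valued.v b ≤ Valued.v ϖ ^ n → ∃ b' ∈ B, Valued.v (b - b') ≤ Valued.v ϖ ^ (2 * M) := by
    intro b hσb hb
    refine hB2 b hσb ?_
    rcases Nat.lt_or_ge n (2 * u) with hlt | hge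
    · -- `n` odd, `2u = n + 1`: a fixed element drops to the next even level
      have h2u : 2 * u = 2 * (u - 1) + 2 := by omega
      rw [h2u]
      exact v_le_pow_succ_succ_of_fixed_of_v_lt hfix hϖ (u - 1) hσb (hb.trans_lt ((hpwlt _ _).2 (by omega)))
    · rwa [show 2 * u = n by omega]
  refine ⟨B.image (fun b => 1 + b), image_one_add_sub hD hn B hB1', image_one_add_existsUnique hD hn hMk hkM hdM hMk2 B hB1' hB2' hB3⟩

end Summit.HodgeConjecture.HodgeConjecture.Cruxes.H413.F0P3cDyRamLabelledOddGlueWindowSigns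

end
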